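import Literature.Analysis.FluidPDE.NSFiniteEnergySmooth
import Literature.Analysis.FluidPDE.TaoEnstrophyLocalisationProofs
import Literature.Analysis.FluidPDE.NSUnconditionalUniquenessProofs
import HarnessLib

/-!
# Tao (2011/2013), enstrophy localisation (Thm. 10.1): decomposition along the printed proof
# — bounded total speed (Prop. 9.1) and the a priori form of Thm. 10.1

Third layer of the decomposition of the vendored forms of Tao 2011, Cor. 11.4
(`NS.tao_unconditional_uniqueness`, `NS.tao_unconditional_uniqueness_velocity`,
`NS.tao_finite_energy_velocity_uniqueness`) and of `NS.tao2011_hasBoundedSobolevNormsOn`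
(Cor. 11.1 + Cor. 4.3 + Thm. 5.4 (iv)). After `TaoEnstrophyLocalisation.lean` and
`TaoEnstrophyLocalisationProofs.lean` (which **proves** the Fourier step
`NS.tao2011_sobolev_of_vorticity`), the `A`-side of both chains — Cor. 11.1, bounded enstrophy —
rests on the single named fact `NS.tao2011_enstrophyLocalisation_exterior`: Tao's **Thm. 10.1**
(*Enstrophy localisation*, arXiv Thm. 59, p. 30) in the exterior-region form of Remark 10.6
(arXiv Rem. 64, p. 33). This file splits that fact along its printed proof (§10, arXiv
pp. 30–33), which is a local energy (enstrophy) argument using exactly two *global* a priori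
inputs about the finite energy almost smooth solution `u`:

1. **Prop. 9.1** (*Bounded total speed*, arXiv Prop. 52, p. 27):
   `‖u‖_{L¹_t L^∞_x([0,T] × ℝ³)} ≲ E(u₀,f,T)^{1/2} T^{1/4} + E(u₀,f,T)` — used once, to keep the
   shrinking radius `R'(t) = R' − c⁻¹ ∫₀ᵗ ‖u(s)‖_{L^∞_x} ds` above `R − r/2` ("Note that the
   bounded total speed property (Proposition 9.1) prevents us from running the radius down to
   zero"); its proof is Littlewood–Paley theory on the Duhamel formula (heat-kernel decay,
   Bernstein, paraproduct trichotomy, Schur's test), a theory absent from Mathlib. Vendored here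
   as the named fact `NS.tao2011_boundedTotalSpeed`.
2. **Lemma 8.1** (*Global energy inequality*, arXiv Lemma 44, p. 24):
   `‖u‖_{L^∞_t L²_x} + ‖∇u‖_{L²_t L²_x} ≲ E(u₀,f,T)^{1/2}` — used for the pigeonhole choice of `R'`
   ("From Lemma 8.1, the right-hand side is `O(δ²E₀/c^{0.1})`", via `∫∫|ω|² ≤ 2∫∫|∇u|²`) and in
   the bound for `Y_{6,2}`
   ("we use Lemma 8.1 to bound `r_i^{-3/2}‖u‖_{L²(2B_i)} ≲ c^{-0.15}δ³E₀^{1/2}`").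
   Already vendored: `NS.tao_finite_energy_smooth_energy_bound` (`NSFiniteEnergySmooth.lean`).

Everything else in §10 (the Lipschitz time-dependent cut-off `η`, the localised enstrophy
`W(t)`, the terms `Y₁,…,Y₆`, the Whitney decomposition, the local Biot–Savart law with harmonic
remainder, Sobolev and Poincaré on balls, the continuity method) is local analysis on the given
solution in which `E₀ = E(u₀, f, T)` enters **only** through the two inputs above. We therefore
vendor the conclusion of §10 with the two inputs turned into hypotheses —
`NS.tao2011_enstrophyLocalisation_exterior_apriori`: for a classical solution obeying
`sup_t ½‖u(t)‖²_{L²} ≤ E`, `ν ∫₀ᵀ∫|∇u|² ≤ E` and `∫₀ᵀ ‖u(t)‖_{L^∞} dt ≤ M`, the hypotheses (10.1),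
(10.2) and `r > C (E + M + δ⁻²)` (the form in which (10.3) is used: `R'(t) ≥ R' − M/c ≥ R − r/2`
and `r ≳ c^{-0.1} E`, `r ≳ c^{0.1}δ⁻²`) give the exterior enstrophy bounds of Remark 10.6 — and we
**prove**

* `NS.tao2011_enstrophyLocalisation_exterior_of_parts :
    tao_finite_energy_smooth_energy_bound → tao2011_boundedTotalSpeed →
    tao2011_enstrophyLocalisation_exterior_apriori → tao2011_enstrophyLocalisation_exterior`
  (glue: Lemma 8.1 turns the finite-energy hypothesis into the two energy-class bounds with
  `E' = 2 max(1, C₈.₁) E`, Prop. 9.1 supplies `M = K (E^{1/2}T^{1/4} + E)`, and (10.2)–(10.3) for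
  `E` imply their primed versions after adjusting the absolute constants);
* the converse `NS.tao2011_enstrophyLocalisation_exterior_apriori_of_exterior :
    tao2011_enstrophyLocalisation_exterior → tao2011_enstrophyLocalisation_exterior_apriori`,
  which shows that the a priori form is **implied by the printed Thm. 10.1** (so it asserts
  nothing beyond the source): under (10.2), `δ⁴T ≤ c ≤ 1` gives `T^{1/4} ≤ δ⁻¹`, whence
  `E^{1/2}T^{1/4} ≤ E^{1/2}δ⁻¹ ≤ ½(E + δ⁻²)` and (10.3) is implied by `r > (3/2)·C (E + δ⁻²)`;
* the resulting leaf structure of Cor. 11.1 and Cor. 11.4: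
  `NS.tao2011_boundedEnstrophy_of_leaves` (Lemma 8.1 + Prop. 9.1 + §10 ⇒ Cor. 11.1, the Fourier
  step being proved) and `NS.tao_unconditional_uniqueness_of_leaves`
  (… + Cor. 4.3/Thm. 5.4 (iii) in the composite form `tao2011_velocity_eq_of_memSobolevX` ⇒
  Cor. 11.4 as printed, its velocity form, and the duplicate vendoring
  `tao_finite_energy_velocity_uniqueness`).

## Dictionary and viscosity (as in `TaoEnstrophyLocalisation.lean`)

Classical solutions on the **closed** slab `[0, T] × ℝ³` (`Fluid.IsClassicalNSSolutionOn (Icc 0 T)`,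
a subclass of Tao's almost smooth solutions); homogeneous case `f = 0`, so
`E(u₀, 0, T) = ½‖u₀‖²_{L²}` and every fact is stated for any `E ≥ E(u₀, 0, T)` (all conditions are
monotone in `E`); `‖u(t)‖_{L^∞_x}` is Mathlib's `eLpNorm (u t) ∞ volume` (the essential supremum,
equal to the supremum for the continuous slices), and `L¹_t`, `L²_t` norms over `[0, T]` are lower
Lebesgue integrals over `Ioo 0 T`; `|∇u|²` is the accepted dissipation density
`Fluid.frobeniusNormSq (fderiv ℝ (u t) x)` (the form of `tao_finite_energy_smooth_energy_bound`).
Tao normalises `ν = 1` (footnote 3); for `ν > 0` the substitution `v(s, x) = ν⁻¹u(s/ν, x)`,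
`q(s, x) = ν⁻²p(s/ν, x)` gives a `ν = 1` solution on `[0, νT]` with
`E ↦ ν⁻²E`, `∫₀ᵀ‖u‖_{L^∞} dt` unchanged, `δ ↦ ν⁻¹δ`, `ω ↦ ν⁻¹ω`, lengths unchanged, whence the
quantifier pattern `∀ ν > 0, ∃ constants` used throughout (`K(ν) = K max(ν^{-3/4}, ν⁻²)` in
Prop. 9.1; `c(ν) = c min(ν³, ν⁵)`, `C(ν) = C max(ν⁻², ν²)`, `A(ν) = A max(1, ν^{-1/2})` in
Thm. 10.1).

## Mathlib / tree search

`lean search 'total_speed|totalSpeed|TotalSpeed'`, `'bounded total speed'`: nothing in Mathlib or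
the tree. The Littlewood–Paley machinery of the printed proof of Prop. 9.1: Mathlib (this pin)
has none; the tree's `Literature/Analysis/FunctionSpaces/LittlewoodPaley.lean` defines the dyadic
blocks `Δ̇_j` on `𝓢'` and Besov norms (with their basic properties as named facts) but has no
Bernstein inequality, heat-semigroup frequency decay or paraproduct estimate, so Prop. 9.1 stays a
named fact. Lemma 8.1 is `NS.tao_finite_energy_smooth_energy_bound` (reused, not restated);
Thm. 10.1 (exterior) is `NS.tao2011_enstrophyLocalisation_exterior` (reused); the Fourier step is
the proved `NS.tao2011_sobolev_of_vorticity_holds` (`TaoEnstrophyLocalisationProofs.lean`).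

## References

* T. Tao, *Localisation and compactness properties of the Navier–Stokes global regularity
  problem*, Anal. PDE 6 (2013), 25–107; arXiv:1108.1165 (`Tao2011`): (2) p. 3 (`E(u₀,f,T)`),
  footnote 3 p. 4, Lemma 8.1 (arXiv Lemma 44, p. 24), Prop. 9.1 and Remarks 9.2–9.5 (arXiv
  Prop. 52, Rem. 53–56, pp. 27–28), Thm. 10.1, Remarks 10.2, 10.6 and the proof of Thm. 10.1
  (arXiv Thm. 59, Rem. 60, 64, pp. 30–33), Cor. 11.1 (arXiv Cor. 68, p. 36), Cor. 11.4 and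
  Remark 11.3 (arXiv Cor. 71, p. 36).
-/

noncomputable section

open MeasureTheory Set Function Filter Topology
open scoped ENNReal NNReal

namespace Literature.Analysis.FluidPDE

/-- Local notation for physical space `ℝ³ = EuclideanSpace ℝ (Fin 3)`. -/
local notation "ℝ³" => EuclideanSpace ℝ (Fin 3)

/-! ## The two named facts -/

/-- **Tao 2011, Prop. 9.1 (Bounded total speed)** (arXiv Prop. 52, p. 27). Printed statement
(`ν = 1`): "Let `(u, p, u₀, f, T)` be a finite energy almost smooth solution. Then we have
`‖u‖_{L¹_t L^∞_x([0,T] × ℝ³)} ≲ E(u₀,f,T)^{1/2} T^{1/4} + E(u₀,f,T)`" (absolute implied constant),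
where `E(u₀,f,T) := ½(‖u₀‖_{L²_x(ℝ³)} + ‖f‖_{L¹_t L²_x([0,T] × ℝ³)})²` ((2), p. 3). Vendored in the
homogeneous case `f = 0` (so `E(u₀, 0, T) = ½‖u₀‖²_{L²}`, and the bound holds a fortiori with any
`E ≥ E(u₀, 0, T)`), for classical solutions on the **closed** slab `[0, T] × ℝ³`
(`Fluid.IsClassicalNSSolutionOn (Icc 0 T)`, a subclass of Tao's almost smooth solutions) of finite
energy in Tao's sense ((6): `sup_{t ∈ [0,T]} ∫|u(t)|² < ∞`), with `‖u(t)‖_{L^∞_x}` the essential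
supremum `eLpNorm (u t) ∞ volume` and the `L¹_t` norm a lower Lebesgue integral over `(0, T)`.
**Viscosity.** For `ν > 0` the rescaling `v(s, x) = ν⁻¹u(s/ν, x)` (a `ν = 1` solution on
`[0, νT]`, footnote 3) has `E(v₀) = ν⁻²E(u₀)` and `∫₀^{νT} ‖v(s)‖_{L^∞} ds = ∫₀ᵀ ‖u(t)‖_{L^∞} dt`,
so the printed bound gives `∫₀ᵀ ‖u(t)‖_{L^∞} dt ≤ K (ν^{-3/4} E^{1/2} T^{1/4} + ν⁻² E)`, whence the
pattern `∀ ν > 0, ∃ K` (`K(ν) = K max(ν^{-3/4}, ν⁻²)`). The proof (Littlewood–Paley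
decomposition of the Duhamel formula, heat-kernel decay, Bernstein's inequality, Schur's test)
is not reproduced. [cite: Tao2011, Prop. 9.1] -/
def tao2011_boundedTotalSpeed : Prop :=
  ∀ ⦃ν : ℝ⦄ (_hν : 0 < ν), ∃ K : ℝ, 0 < K ∧
    ∀ ⦃T : ℝ⦄ (_hT : 0 < T) ⦃u : ℝ → ℝ³ → ℝ³⦄ ⦃p : ℝ → ℝ³ → ℝ⦄
      (_hsol : FluidPDE.IsClassicalNSSolutionOn (Icc 0 T) ν 0 u p)
      (_hfe : ∃ C' : ℝ≥0, ∀ t ∈ Icc 0 T, ∫⁻ x, ‖u t x‖ₑ ^ 2 ≤ C')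
      ⦃E : ℝ⦄ (_hE : 0 ≤ E) (_hE₀ : ∫⁻ x, ‖u 0 x‖ₑ ^ 2 ≤ ENNReal.ofReal (2 * E)),
      ∫⁻ t in Ioo 0 T, eLpNorm (u t) ∞ volume ≤
        ENNReal.ofReal (K * (Real.sqrt E * T ^ (1 / 4 : ℝ) + E))

/-- **Tao 2011, Thm. 10.1 (Enstrophy localisation) in the exterior form of Remark 10.6, a priori
form** — the statement established by the printed proof of Thm. 10.1 (§10, arXiv pp. 30–33)
once its two global inputs, Prop. 9.1 (bounded total speed) and Lemma 8.1 (global energy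
inequality), are made hypotheses. Printed theorem (`ν = 1`, ball form; Remark 10.6 for the
exterior form): for a finite energy almost smooth solution with
`‖ω₀‖_{L²(ℝ³ ∖ B(x₀,R))} ≤ δ` (10.1, `f = 0`), `δ⁴T + δ⁵E(u₀,f,T)^{1/2}T ≤ c` (10.2) and
`R/2 > r > C(E(u₀,f,T) + E(u₀,f,T)^{1/2}T^{1/4} + δ⁻²)` (10.3), one has
`‖ω‖_{L^∞_t L²_x([0,T] × (ℝ³ ∖ B(x₀,R+r)))} + ‖∇ω‖_{L²_t L²_x([0,T] × (ℝ³ ∖ B(x₀,R+r)))} ≲ δ`.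
In the proof `E₀ = E(u₀,f,T)` enters only through Lemma 8.1 (`‖u‖_{L^∞_t L²_x} ≲ E₀^{1/2}` in
the bound for `Y_{6,2}`; `‖∇u‖_{L²_t L²_x} ≲ E₀^{1/2}` in the pigeonhole choice of `R'`, which
needs `r ≳ c^{-0.1}E₀`) and through Prop. 9.1 (`R'(t) = R' − c⁻¹∫₀ᵗ‖u(s)‖_{L^∞} ds ≥ R − r/2`,
which needs `r ≥ 2c⁻¹ ‖u‖_{L¹_t L^∞_x}`), besides `r ≳ c^{0.1}δ⁻²` (so that `η = 1` on
`B(0, R − r)`). Hence the form vendored here: for a classical solution on the **closed** slab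
`[0, T] × ℝ³` (a subclass of almost smooth) and numbers `E, M ≥ 0` with
`sup_{t ∈ [0,T]} ∫|u(t)|² ≤ 2E`, `ν ∫₀ᵀ ∫ |∇u|² ≤ E` and `∫₀ᵀ ‖u(t)‖_{L^∞_x} dt ≤ M`, the
hypotheses (10.1), (10.2) and `R/2 > r > C(E + M + δ⁻²)` imply the two exterior bounds, each by
`(Aδ)²` (dictionary for `ω`, `|∇ω|`, `L^∞_t` as in `tao2011_enstrophyLocalisation_exterior`).
This statement is moreover a **formal consequence of the printed Thm. 10.1**
(`tao2011_enstrophyLocalisation_exterior_apriori_of_exterior`, proved below: under (10.2) with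
`c ≤ 1`, `T^{1/4} ≤ δ⁻¹` and `E^{1/2}T^{1/4} ≤ ½(E + δ⁻²)`), so it asserts nothing beyond the
source; conversely Thm. 10.1 follows from it, Prop. 9.1 and Lemma 8.1
(`tao2011_enstrophyLocalisation_exterior_of_parts`). Viscosity `ν > 0` from `ν = 1` by the
rescaling `v(s, x) = ν⁻¹u(s/ν, x)` (`E ↦ ν⁻²E`, `M ↦ M`, `δ ↦ ν⁻¹δ`, `T ↦ νT`, `ω ↦ ν⁻¹ω`), whence
`∀ ν > 0, ∃ c C A`. [cite: Tao2011, Thm. 10.1 (proof, §10) + Remark 10.6] -/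
def tao2011_enstrophyLocalisation_exterior_apriori : Prop :=
  ∀ ⦃ν : ℝ⦄ (_hν : 0 < ν), ∃ c C A : ℝ, 0 < c ∧ 0 < C ∧ 0 < A ∧
    ∀ ⦃T : ℝ⦄ (_hT : 0 < T) ⦃u : ℝ → ℝ³ → ℝ³⦄ ⦃p : ℝ → ℝ³ → ℝ⦄
      (_hsol : FluidPDE.IsClassicalNSSolutionOn (Icc 0 T) ν 0 u p)
      ⦃E M : ℝ⦄ (_hE : 0 ≤ E) (_hM : 0 ≤ M)
      (_hEt : ∀ t ∈ Icc 0 T, ∫⁻ x, ‖u t x‖ₑ ^ 2 ≤ ENNReal.ofReal (2 * E))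
      (_hD : ENNReal.ofReal ν *
          ∫⁻ t in Ioo 0 T, ∫⁻ x, ENNReal.ofReal (FluidPDE.frobeniusNormSq (fderiv ℝ (u t) x)) ≤
        ENNReal.ofReal E)
      (_hMt : ∫⁻ t in Ioo 0 T, eLpNorm (u t) ∞ volume ≤ ENNReal.ofReal M)
      (x₀ : ℝ³) ⦃R r δ : ℝ⦄ (_hδ : 0 < δ) (_hr : 0 < r) (_hrR : r < R / 2)
      (_hω₀ : ∫⁻ x in (Metric.ball x₀ R)ᶜ, ‖FluidPDE.curl (u 0) x‖ₑ ^ 2 ≤ ENNReal.ofReal (δ ^ 2))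
      (_hsmall : δ ^ 4 * T + δ ^ 5 * Real.sqrt E * T ≤ c)
      (_hlarge : C * (E + M + δ⁻¹ ^ 2) < r),
      (∀ t ∈ Icc 0 T, ∫⁻ x in (Metric.ball x₀ (R + r))ᶜ, ‖FluidPDE.curl (u t) x‖ₑ ^ 2 ≤
          ENNReal.ofReal ((A * δ) ^ 2)) ∧
        ∫⁻ t in Ioo 0 T, ∫⁻ x in (Metric.ball x₀ (R + r))ᶜ,
            ‖fderiv ℝ (FluidPDE.curl (u t)) x‖ₑ ^ 2 ≤ ENNReal.ofReal ((A * δ) ^ 2)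

/-! ## Elementary inequalities used in the two assemblies -/

/-- If `δ⁴T ≤ 1` (in particular under the smallness condition (10.2) with `c ≤ 1`) then
`T^{1/4} ≤ δ⁻¹`. [folklore] -/
theorem rpow_quarter_le_inv {δ T : ℝ} (hδ : 0 < δ) (hT : 0 ≤ T) (h1 : δ ^ 4 * T ≤ 1) :
    T ^ (1 / 4 : ℝ) ≤ δ⁻¹ := by
  have hδ4 : 0 < δ ^ 4 := by positivity
  have hT' : T ≤ δ⁻¹ ^ 4 := by
    rw [inv_pow, ← one_div, le_div_iff₀ hδ4]
    linarith [mul_comm (δ ^ 4) T]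
  calc T ^ (1 / 4 : ℝ) ≤ (δ⁻¹ ^ 4) ^ (1 / 4 : ℝ) := Real.rpow_le_rpow hT hT' (by norm_num)
    _ = δ⁻¹ := by
      rw [show (1 / 4 : ℝ) = ((4 : ℕ) : ℝ)⁻¹ by norm_num]
      exact Real.pow_rpow_inv_natCast (inv_nonneg.2 hδ.le) (by norm_num)

/-- The step "(10.3) is implied by `r > (3/2)·C(E + δ⁻²)` under (10.2)": if `T^{1/4} ≤ δ⁻¹`
then `E^{1/2} T^{1/4} ≤ E^{1/2} δ⁻¹ ≤ ½ (E + δ⁻²)` (arithmetic–geometric mean). [folklore] -/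
theorem sqrt_mul_le_half_add {δ E a : ℝ} (hE : 0 ≤ E) (ha : a ≤ δ⁻¹) :
    Real.sqrt E * a ≤ (E + δ⁻¹ ^ 2) / 2 := by
  have h1 : Real.sqrt E * a ≤ Real.sqrt E * δ⁻¹ :=
    mul_le_mul_of_nonneg_left ha (Real.sqrt_nonneg _)
  have h2 : 2 * Real.sqrt E * δ⁻¹ ≤ Real.sqrt E ^ 2 + δ⁻¹ ^ 2 := two_mul_le_add_sq _ _
  rw [Real.sq_sqrt hE] at h2
  linarith

/-- Under (10.2) with `c ≤ 1`: `E + E^{1/2}T^{1/4} + δ⁻² ≤ (3/2)(E + δ⁻²)`. [folklore] -/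
theorem add_sqrt_mul_rpow_add_le_of_small {δ T E c : ℝ} (hδ : 0 < δ) (hT : 0 ≤ T) (hE : 0 ≤ E)
    (hc : c ≤ 1) (hsmall : δ ^ 4 * T + δ ^ 5 * Real.sqrt E * T ≤ c) :
    E + Real.sqrt E * T ^ (1 / 4 : ℝ) + δ⁻¹ ^ 2 ≤ 3 / 2 * (E + δ⁻¹ ^ 2) := by
  have h1 : δ ^ 4 * T ≤ 1 := by
    have : 0 ≤ δ ^ 5 * Real.sqrt E * T := by positivity
    linarith
  have h2 := sqrt_mul_le_half_add hE (rpow_quarter_le_inv hδ hT h1)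
  linarith

/-! ## The a priori form is implied by the printed theorem -/

/-- **The a priori form of Thm. 10.1 asserts nothing beyond the printed Thm. 10.1** (exterior
form): given `tao2011_enstrophyLocalisation_exterior` with constants `(c, C, A)`, the a priori
form holds with `(min c 1, 2C, A)` — the energy hypothesis at `t = 0` gives `E ≥ E(u₀, 0, T)`
and finite energy, and under (10.2) with `c ≤ 1` one has `T^{1/4} ≤ δ⁻¹`, so
`C(E + E^{1/2}T^{1/4} + δ⁻²) ≤ (3/2)C(E + δ⁻²) ≤ 2C(E + M + δ⁻²) < r`; the dissipation and
total-speed hypotheses are simply not needed. PROVED. [cite: Tao2011, Thm. 10.1 + Remark 10.6] -/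
theorem tao2011_enstrophyLocalisation_exterior_apriori_of_exterior
    (hA : tao2011_enstrophyLocalisation_exterior) :
    tao2011_enstrophyLocalisation_exterior_apriori := by
  intro ν hν
  obtain ⟨c₀, C₀, A₀, hc₀, hC₀, hA₀, hmain⟩ := hA hν
  refine ⟨min c₀ 1, 2 * C₀, A₀, lt_min hc₀ one_pos, by positivity, hA₀, ?_⟩
  intro T hT u p hsol E M hE hM hEt _hD _hMt x₀ R r δ hδ hr hrR hω₀ hsmall hlarge
  have hfe : ∃ C' : ℝ≥0, ∀ t ∈ Icc 0 T, ∫⁻ x, ‖u t x‖ₑ ^ 2 ≤ C' :=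
    ⟨(ENNReal.ofReal (2 * E)).toNNReal, fun t ht =>
      (hEt t ht).trans_eq (ENNReal.coe_toNNReal ENNReal.ofReal_ne_top).symm⟩
  have hE₀ : ∫⁻ x, ‖u 0 x‖ₑ ^ 2 ≤ ENNReal.ofReal (2 * E) := hEt 0 ⟨le_rfl, hT.le⟩
  have hsmall₀ : δ ^ 4 * T + δ ^ 5 * Real.sqrt E * T ≤ c₀ := hsmall.trans (min_le_left _ _)
  have h32 := add_sqrt_mul_rpow_add_le_of_small hδ hT.le hE (min_le_right c₀ 1) hsmall
  have hδ2 : 0 ≤ δ⁻¹ ^ 2 := by positivity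
  have hlarge₀ : C₀ * (E + Real.sqrt E * T ^ (1 / 4 : ℝ) + δ⁻¹ ^ 2) < r :=
    calc C₀ * (E + Real.sqrt E * T ^ (1 / 4 : ℝ) + δ⁻¹ ^ 2)
        ≤ C₀ * (2 * (E + M + δ⁻¹ ^ 2)) := by
          refine mul_le_mul_of_nonneg_left ?_ hC₀.le
          linarith
      _ = 2 * C₀ * (E + M + δ⁻¹ ^ 2) := by ring
      _ < r := hlarge
  exact hmain hT hsol hfe hE hE₀ x₀ hδ hr hrR hω₀ hsmall₀ hlarge₀

/-! ## Thm. 10.1 (exterior form) from Lemma 8.1, Prop. 9.1 and the a priori form -/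

/-- **Assembly (proved): Tao 2011, Thm. 10.1 in the exterior form of Remark 10.6
(`tao2011_enstrophyLocalisation_exterior`) from its printed ingredients** — the global energy
inequality Lemma 8.1 (`tao_finite_energy_smooth_energy_bound`), the bounded total speed
Prop. 9.1 (`tao2011_boundedTotalSpeed`) and the §10 argument
(`tao2011_enstrophyLocalisation_exterior_apriori`). Given a finite energy classical solution and
`E ≥ ½‖u₀‖²_{L²}`: Lemma 8.1 gives `sup_t ∫|u(t)|² ≤ C₈ ∫|u₀|² ≤ 2C₈E` and
`ν∫₀ᵀ∫|∇u|² ≤ 2C₈E`, i.e. the energy-class hypotheses of the a priori form with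
`E' = 2 max(1, C₈) E`; Prop. 9.1 gives the total-speed hypothesis with
`M = K(E^{1/2}T^{1/4} + E)`; and with `s = (2 max(1, C₈))^{1/2} ≥ 1`, `L = 2 max(1, C₈) + K + 1`
the printed conditions `δ⁴T + δ⁵E^{1/2}T ≤ c₁/s` and `C₁ L (E + E^{1/2}T^{1/4} + δ⁻²) < r` imply
the conditions `δ⁴T + δ⁵E'^{1/2}T ≤ c₁`, `C₁(E' + M + δ⁻²) < r` of the a priori form. So Thm. 10.1
holds with constants `(c₁/s, C₁L, A₁)`. [cite: Tao2011, Thm. 10.1 (proof, §10) + Remark 10.6] -/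
theorem tao2011_enstrophyLocalisation_exterior_of_parts
    (hL : tao_finite_energy_smooth_energy_bound) (hP : tao2011_boundedTotalSpeed)
    (hA' : tao2011_enstrophyLocalisation_exterior_apriori) :
    tao2011_enstrophyLocalisation_exterior := by
  obtain ⟨C₈, hC₈top, h81⟩ := hL
  intro ν hν
  obtain ⟨K, hK, hP⟩ := hP hν
  obtain ⟨c₁, C₁, A₁, hc₁, hC₁, hA₁, hmain⟩ := hA' hν
  -- the constant of Lemma 8.1 as a real number `≥ 1`
  set c₈ : ℝ := max 1 C₈.toReal with hc₈def
  have hc₈1 : 1 ≤ c₈ := le_max_left _ _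
  have hc₈0 : 0 < c₈ := one_pos.trans_le hc₈1
  have hC₈le : C₈ ≤ ENNReal.ofReal c₈ := by
    rw [← ENNReal.ofReal_toReal hC₈top.ne]
    exact ENNReal.ofReal_le_ofReal (le_max_right _ _)
  set s : ℝ := Real.sqrt (2 * c₈) with hsdef
  have hs1 : 1 ≤ s := by
    rw [hsdef, ← Real.sqrt_one]
    exact Real.sqrt_le_sqrt (by linarith)
  have hs0 : 0 < s := one_pos.trans_le hs1
  set L : ℝ := 2 * c₈ + K + 1 with hLdef
  have hL0 : 0 < L := by positivity
  refine ⟨c₁ / s, C₁ * L, A₁, div_pos hc₁ hs0, mul_pos hC₁ hL0, hA₁, ?_⟩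
  intro T hT u p hsol hfe E hE hE₀ x₀ R r δ hδ hr hrR hω₀ hsmall hlarge
  -- Lemma 8.1: the two energy-class bounds, with `E' = 2 c₈ E`
  have hfe' : ∃ A : ℝ≥0∞, A < ⊤ ∧ ∀ t ∈ Icc 0 T, ∫⁻ x, ‖u t x‖ₑ ^ 2 ≤ A := by
    obtain ⟨C', hC'⟩ := hfe
    exact ⟨C', ENNReal.coe_lt_top, hC'⟩
  obtain ⟨h81a, h81b⟩ := h81 ν T hν hT u p hsol hfe'
  have hkey : C₈ * ∫⁻ x, ‖u 0 x‖ₑ ^ 2 ≤ ENNReal.ofReal (2 * c₈ * E) :=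
    calc C₈ * ∫⁻ x, ‖u 0 x‖ₑ ^ 2 ≤ ENNReal.ofReal c₈ * ENNReal.ofReal (2 * E) :=
          mul_le_mul' hC₈le hE₀
      _ = ENNReal.ofReal (2 * c₈ * E) := by
          rw [← ENNReal.ofReal_mul hc₈0.le]
          congr 1
          ring
  set E' : ℝ := 2 * c₈ * E with hE'def
  have hE'0 : 0 ≤ E' := by positivity
  have hEt : ∀ t ∈ Icc 0 T, ∫⁻ x, ‖u t x‖ₑ ^ 2 ≤ ENNReal.ofReal (2 * E') := fun t ht =>
    ((h81a t ht).trans hkey).trans (ENNReal.ofReal_le_ofReal (by rw [hE'def]; nlinarith))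
  have hD : ENNReal.ofReal ν *
      ∫⁻ t in Ioo 0 T, ∫⁻ x, ENNReal.ofReal (FluidPDE.frobeniusNormSq (fderiv ℝ (u t) x)) ≤
        ENNReal.ofReal E' :=
    h81b.trans hkey
  -- Prop. 9.1: the total-speed bound `M`
  set M : ℝ := K * (Real.sqrt E * T ^ (1 / 4 : ℝ) + E) with hMdef
  have ha0 : 0 ≤ Real.sqrt E * T ^ (1 / 4 : ℝ) := by positivity
  have hM0 : 0 ≤ M := by positivity
  have hMt : ∫⁻ t in Ioo 0 T, eLpNorm (u t) ∞ volume ≤ ENNReal.ofReal M :=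
    hP hT hsol hfe hE hE₀
  -- (10.2) for `E'`
  have hsqrtE' : Real.sqrt E' = s * Real.sqrt E := by
    rw [hE'def, hsdef, ← Real.sqrt_mul (by positivity : (0 : ℝ) ≤ 2 * c₈)]
  have hsmall' : δ ^ 4 * T + δ ^ 5 * Real.sqrt E' * T ≤ c₁ := by
    have h4 : 0 ≤ δ ^ 4 * T := by positivity
    have h5 : 0 ≤ δ ^ 5 * Real.sqrt E * T := by positivity
    have h1 : δ ^ 4 * T + δ ^ 5 * Real.sqrt E' * T ≤
        s * (δ ^ 4 * T + δ ^ 5 * Real.sqrt E * T) := by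
      rw [hsqrtE']
      have : δ ^ 4 * T ≤ s * (δ ^ 4 * T) := le_mul_of_one_le_left h4 hs1
      nlinarith
    have h2 : s * (δ ^ 4 * T + δ ^ 5 * Real.sqrt E * T) ≤ s * (c₁ / s) :=
      mul_le_mul_of_nonneg_left hsmall hs0.le
    have h3 : s * (c₁ / s) = c₁ := by field_simp
    linarith
  -- (10.3) for `E'`, `M`
  have hlarge' : C₁ * (E' + M + δ⁻¹ ^ 2) < r := by
    have hδ2 : 0 ≤ δ⁻¹ ^ 2 := by positivity
    have h1 : E' + M + δ⁻¹ ^ 2 ≤ L * (E + Real.sqrt E * T ^ (1 / 4 : ℝ) + δ⁻¹ ^ 2) := by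
      rw [hE'def, hMdef, hLdef]
      have i1 : 0 ≤ c₈ * (Real.sqrt E * T ^ (1 / 4 : ℝ)) := mul_nonneg hc₈0.le ha0
      have i2 : 0 ≤ c₈ * δ⁻¹ ^ 2 := mul_nonneg hc₈0.le hδ2
      have i3 : 0 ≤ K * δ⁻¹ ^ 2 := mul_nonneg hK.le hδ2
      nlinarith
    calc C₁ * (E' + M + δ⁻¹ ^ 2)
        ≤ C₁ * (L * (E + Real.sqrt E * T ^ (1 / 4 : ℝ) + δ⁻¹ ^ 2)) :=
          mul_le_mul_of_nonneg_left h1 hC₁.le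
      _ = C₁ * L * (E + Real.sqrt E * T ^ (1 / 4 : ℝ) + δ⁻¹ ^ 2) := by ring
      _ < r := hlarge
  exact hmain hT hsol hE'0 hM0 hEt hD hMt x₀ hδ hr hrR hω₀ hsmall' hlarge'

/-! ## Leaf structure of Cor. 11.1 and Cor. 11.4 after this file -/

/-- **Cor. 11.1 (bounded enstrophy) from its printed leaves**: Lemma 8.1, Prop. 9.1 and the
§10 argument give Thm. 10.1 (`tao2011_enstrophyLocalisation_exterior_of_parts`), and with the
proved Fourier step (`tao2011_sobolev_of_vorticity_holds`) Cor. 11.1 follows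
(`tao2011_boundedEnstrophy_of_parts`). [cite: Tao2011, Cor. 11.1] -/
theorem tao2011_boundedEnstrophy_of_leaves (hL : tao_finite_energy_smooth_energy_bound)
    (hP : tao2011_boundedTotalSpeed) (hA' : tao2011_enstrophyLocalisation_exterior_apriori) :
    tao2011_boundedEnstrophy :=
  tao2011_boundedEnstrophy_of_parts (tao2011_enstrophyLocalisation_exterior_of_parts hL hP hA')
    tao2011_sobolev_of_vorticity_holds

/-- **Cor. 11.4 from its printed leaves**: Lemma 8.1, Prop. 9.1, the §10 argument (whence
Cor. 11.1, `tao2011_boundedEnstrophy_of_leaves`) and Cor. 4.3 + Thm. 5.4 (iii) in the composite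
form `tao2011_velocity_eq_of_memSobolevX` give Cor. 11.4 as printed
(`tao_unconditional_uniqueness`), its velocity form, and the duplicate vendoring
`tao_finite_energy_velocity_uniqueness` (Remark 11.3's chain, assembled by
`tao_unconditional_uniqueness_velocity_of_parts`). [cite: Tao2011, Cor. 11.4 (Remark 11.3)] -/
theorem tao_unconditional_uniqueness_of_leaves (hL : tao_finite_energy_smooth_energy_bound)
    (hP : tao2011_boundedTotalSpeed) (hA' : tao2011_enstrophyLocalisation_exterior_apriori)
    (hB : tao2011_velocity_eq_of_memSobolevX) :
    tao_unconditional_uniqueness ∧ tao_unconditional_uniqueness_velocity ∧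
      tao_finite_energy_velocity_uniqueness := by
  have hv := tao_unconditional_uniqueness_velocity_of_parts
    (tao2011_boundedEnstrophy_of_leaves hL hP hA') hB
  exact ⟨tao_unconditional_uniqueness.of_velocity hv, hv,
    tao_unconditional_uniqueness_velocity_iff.1 hv⟩

/-- **`tao2011_hasBoundedSobolevNormsOn` (Cor. 11.1 + Cor. 4.3 + Thm. 5.4 (iv)) from its printed
leaves**: the three `A`-side leaves above and the two `B`-side facts of `TaoH1Mild.lean`
(Cor. 4.3 `tao2011_isMildNSSolutionOn_of_memSobolevX`, Thm. 5.4 (iv)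
`tao2011_hasBoundedSobolevNormsOn_of_isMildNSSolutionOn`).
[cite: Tao2011, Cor. 11.1 + Cor. 4.3 + Thm. 5.4 (iv)] -/
theorem tao2011_hasBoundedSobolevNormsOn_of_leaves (hL : tao_finite_energy_smooth_energy_bound)
    (hP : tao2011_boundedTotalSpeed) (hA' : tao2011_enstrophyLocalisation_exterior_apriori)
    (hB₁ : tao2011_isMildNSSolutionOn_of_memSobolevX)
    (hB₂ : tao2011_hasBoundedSobolevNormsOn_of_isMildNSSolutionOn) :
    tao2011_hasBoundedSobolevNormsOn :=
  tao2011_hasBoundedSobolevNormsOn_of_boundedEnstrophy_of_parts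
    (tao2011_boundedEnstrophy_of_leaves hL hP hA') hB₁ hB₂

end Literature.Analysis.FluidPDE

end
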